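import Mathlib
import Summits.ValiantsHypothesis.ValiantsHypothesis.Theses.ElementaryWordLength

/-!
# Sketch (crux-ideate round 2, ideator 4): exits from Lusztig's positive monoid

First lemmas of the idea `positive-monoid-exits` for crux `WordLengthQP`
(stmt-ValiantsHypothesis-6623), stated over existing declarations
(`Matrix.transvection`, `MvPolynomial`, `perPoly`, the route decl `WordLengthQP`).

A REAL word is a list of letters `(i, j, c, v)` with `c : ℝ`; a letter is POSITIVE if `c > 0`
and `(i, j)` is adjacent (`|i - j| = 1`), i.e. it is one of Lusztig's generators
`x₁(a), x₂(a), y₁(a), y₂(a)`, `a > 0`, of the totally nonnegative monoid of `SL₃`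
(with `a = c` or `a = c·x_v`, `x_v` thought of as positive).  `signedCount w` is the number of
non-positive letters of `w` ("exits from the positive monoid").

* `SignBudgetQP` — the bet S: the number of non-positive letters of any real word computing
  `E₀₂(per_n)` is not quasi-polynomially bounded (length-free).
* `RealWordsOfComplexWords` — realification (support, provable now): quasi-polynomial complex
  words for `E₀₂(per_n)` give quasi-polynomial real words.
* `wordLengthQP_of_signBudget` — S + realification ⇒ the crux, PROVED here (pure logic:
  `signedCount w ≤ w.length`).
* `KappaGeTwo` — calibration from below (provable now, total nonnegativity): for `n ≥ 2` every
  real word for `E₀₂(per_n)` has at least two non-positive letters.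
* `TwoStaircase` — calibration from above, PROVED below (`twoStaircase_holds`, Heisenberg-group identity): for any
  commutative ring, `E₀₂(∑ fᵢgᵢ) = R · h'' · R̃ · h''` with `R, R̃` products of `E₀₁(fᵢ), E₁₂(gᵢ)` in
  staircase order and `h'' = diag(-1,1,-1)`; hence bilinear forms in letters cost `O(1)` exits.
-/

namespace Summit.ValiantsHypothesis.ValiantsHypothesis.Cruxes.WordLengthQP.PositiveMonoidExits

set_option linter.dupNamespace false

open Literature.Computability.AlgebraicComplexity

/-- The matrix of a real letter `(i, j, c, v)`: the transvection `E_ij(c)` or `E_ij(c·x_v)`. -/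
noncomputable def letterMat {σ : Type} (l : Fin 3 × Fin 3 × ℝ × Option σ) :
    Matrix (Fin 3) (Fin 3) (MvPolynomial σ ℝ) :=
  Matrix.transvection l.1 l.2.1 (MvPolynomial.C l.2.2.1 * l.2.2.2.elim 1 MvPolynomial.X)

/-- A letter is POSITIVE (a Lusztig generator of the totally nonnegative monoid): positive
coefficient and adjacent indices. -/
def IsPositiveLetter {σ : Type} (l : Fin 3 × Fin 3 × ℝ × Option σ) : Prop :=
  0 < l.2.2.1 ∧ (l.1.val + 1 = l.2.1.val ∨ l.2.1.val + 1 = l.1.val)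

open Classical in
/-- Number of non-positive letters of a real word ("exits from the positive monoid"). -/
noncomputable def signedCount {σ : Type} (w : List (Fin 3 × Fin 3 × ℝ × Option σ)) : ℕ :=
  (w.filter (fun l => !decide (IsPositiveLetter l))).length

/-- A real word `w` is a valid word computing `E₀₂(per_n)` over `ℝ`. -/
def ComputesPer (n : ℕ) (w : List (Fin 3 × Fin 3 × ℝ × Option (Fin n × Fin n))) : Prop :=
  (∀ l ∈ w, l.1 ≠ l.2.1) ∧
    (w.map letterMat).prod = Matrix.transvection (0 : Fin 3) 2 (perPoly (Fin n) ℝ)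

/-- THE BET `S` (length-free sign budget): for every `c`, for all large `n`, every real word
computing `E₀₂(per_n)` leaves Lusztig's positive monoid more than `2^((log₂ n + c)^c)` times. -/
def SignBudgetQP : Prop :=
  ∀ c : ℕ, ∃ n₀ : ℕ, ∀ n ≥ n₀, ∀ w : List (Fin 3 × Fin 3 × ℝ × Option (Fin n × Fin n)),
    ComputesPer n w → 2 ^ ((Nat.log 2 n + c) ^ c) < signedCount w

/-- REALIFICATION (support, provable now: simulate complex arithmetic by pairs of reals in the
circuit, then VQP = VQF and Ben-Or–Cleve over `ℝ`): quasi-polynomial complex words for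
`E₀₂(per_n)` yield quasi-polynomial real words. -/
def RealWordsOfComplexWords : Prop :=
  (∃ c : ℕ, ∀ n : ℕ, ∃ w : List (Fin 3 × Fin 3 × ℂ × Option (Fin n × Fin n)),
      w.length ≤ 2 ^ ((Nat.log 2 n + c) ^ c) ∧ (∀ l ∈ w, l.1 ≠ l.2.1) ∧
      (w.map (fun l => Matrix.transvection l.1 l.2.1
        (MvPolynomial.C l.2.2.1 * l.2.2.2.elim 1 MvPolynomial.X))).prod =
        Matrix.transvection (0 : Fin 3) 2 (perPoly (Fin n) ℂ)) →
  (∃ c : ℕ, ∀ n : ℕ, ∃ w : List (Fin 3 × Fin 3 × ℝ × Option (Fin n × Fin n)),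
      w.length ≤ 2 ^ ((Nat.log 2 n + c) ^ c) ∧ ComputesPer n w)

theorem signedCount_le_length {σ : Type} (w : List (Fin 3 × Fin 3 × ℝ × Option σ)) :
    signedCount w ≤ w.length := by
  unfold signedCount
  exact List.length_filter_le _ _

/-- S + realification ⇒ the crux (pure logic). -/
theorem wordLengthQP_of_signBudget (hS : SignBudgetQP) (hR : RealWordsOfComplexWords) :
    Summit.ValiantsHypothesis.ValiantsHypothesis.Theses.ElementaryWordLength.WordLengthQP := by
  unfold Summit.ValiantsHypothesis.ValiantsHypothesis.Theses.ElementaryWordLength.WordLengthQP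
  intro hC
  obtain ⟨c, hc⟩ := hR hC
  obtain ⟨n₀, hn₀⟩ := hS c
  obtain ⟨w, hwlen, hw⟩ := hc n₀
  have h1 := hn₀ n₀ le_rfl w hw
  have h2 := signedCount_le_length w
  omega

/-- CALIBRATION FROM BELOW (provable now; total nonnegativity of products of positive letters,
Cauchy–Binet, and the minor `Δ_{01,12}(E₀₂(p) + u wᵀ) = -p - p·u₁w₁ - u₀w₂ < 0`): for `n ≥ 2` every
real word computing `E₀₂(per_n)` has at least two non-positive letters. -/
def KappaGeTwo : Prop :=
  ∀ n : ℕ, 2 ≤ n → ∀ w : List (Fin 3 × Fin 3 × ℝ × Option (Fin n × Fin n)),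
    ComputesPer n w → 2 ≤ signedCount w

/-- CALIBRATION FROM ABOVE (provable now, any commutative ring): the two-staircase identity in the
Heisenberg group.  With `h'' = diag(-1,1,-1)`, `R = ∏_{i=0}^{m-1} E₀₁(fᵢ)E₁₂(gᵢ)` and
`R̃ = ∏_{i=m-1}^{0} E₀₁(fᵢ)E₁₂(gᵢ)`:  `R · h'' · R̃ · h'' = E₀₂(∑ᵢ fᵢ gᵢ)`.  Consequence: every bilinear
form in letters `∑ᵢ fᵢ gᵢ` (`fᵢ, gᵢ` nonnegative linear forms) has real words with `O(1)` non-positive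
letters — the sign budget does NOT see bilinear rank. -/
def TwoStaircase : Prop :=
  ∀ (R : Type) [CommRing R] (m : ℕ) (f g : Fin m → R),
    ((List.ofFn fun i : Fin m =>
        Matrix.transvection (0 : Fin 3) 1 (f i) * Matrix.transvection (1 : Fin 3) 2 (g i)).prod *
      Matrix.diagonal ![-1, 1, -1] *
      (List.ofFn fun i : Fin m =>
        Matrix.transvection (0 : Fin 3) 1 (f (Fin.rev i)) *
          Matrix.transvection (1 : Fin 3) 2 (g (Fin.rev i))).prod *
      Matrix.diagonal ![-1, 1, -1]) =
    Matrix.transvection (0 : Fin 3) 2 (∑ i, f i * g i)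

/-- Sanity instance of `TwoStaircase` at `m = 1` over `ℤ` (the Ben-Or–Cleve commutator, signs moved
into the frame `h''`), checked by `decide`-free computation. -/
example (f g : ℤ) :
    Matrix.transvection (0 : Fin 3) 1 f * Matrix.transvection (1 : Fin 3) 2 g *
      Matrix.diagonal ![-1, 1, -1] *
      (Matrix.transvection (0 : Fin 3) 1 f * Matrix.transvection (1 : Fin 3) 2 g) *
      Matrix.diagonal ![-1, 1, -1] =
    Matrix.transvection (0 : Fin 3) 2 (f * g) := by
  ext i j
  fin_cases i <;> fin_cases j <;>
    simp [Matrix.transvection, Matrix.mul_apply, Fin.sum_univ_three, Matrix.single, Matrix.of_apply,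
      Matrix.diagonal, Matrix.one_apply]

/-! ### Proof of `TwoStaircase` (all `m`, any commutative ring) -/

section TwoStaircaseProof

variable {R : Type} [CommRing R]

/-- Upper unitriangular 3×3 matrix. -/
def U (a b c : R) : Matrix (Fin 3) (Fin 3) R := !![1, a, c; 0, 1, b; 0, 0, 1]

/-- `h'' = diag(-1, 1, -1)`. -/
def hpp : Matrix (Fin 3) (Fin 3) R := Matrix.diagonal ![-1, 1, -1]

theorem U_mul (a b c a' b' c' : R) :
    U a b c * U a' b' c' = U (a + a') (b + b') (c + c' + a * b') := by
  ext i j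
  fin_cases i <;> fin_cases j <;>
    simp [U, Matrix.mul_apply, Fin.sum_univ_three] <;> ring

theorem hpp_U_hpp (a b c : R) : hpp * U a b c * hpp = U (-a) (-b) c := by
  ext i j
  fin_cases i <;> fin_cases j <;>
    simp [U, hpp, Matrix.mul_apply, Matrix.diagonal]

theorem transvection01_mul_transvection12 (f g : R) :
    Matrix.transvection (0 : Fin 3) 1 f * Matrix.transvection (1 : Fin 3) 2 g = U f g (f * g) := by
  ext i j
  fin_cases i <;> fin_cases j <;>
    simp [U, Matrix.transvection, Matrix.mul_apply, Fin.sum_univ_three, Matrix.single,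
      Matrix.of_apply, Matrix.one_apply]

theorem transvection02_eq_U (c : R) : Matrix.transvection (0 : Fin 3) 2 c = U 0 0 c := by
  ext i j
  fin_cases i <;> fin_cases j <;>
    simp [U, Matrix.transvection, Matrix.single, Matrix.of_apply]

/-- A product of `U`'s is a `U`. -/
theorem exists_U_of_prod (l : List (R × R × R)) :
    ∃ a b c : R, (l.map fun t => U t.1 t.2.1 t.2.2).prod = U a b c := by
  induction l with
  | nil => exact ⟨0, 0, 0, by
      ext i j; fin_cases i <;> fin_cases j <;> simp [U]⟩
  | cons t l ih =>
      obtain ⟨a, b, c, h⟩ := ih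
      refine ⟨t.1 + a, t.2.1 + b, t.2.2 + c + t.1 * b, ?_⟩
      simp [List.map_cons, List.prod_cons, h, U_mul]

/-- The staircase products. -/
def stairR (m : ℕ) (f g : Fin m → R) : Matrix (Fin 3) (Fin 3) R :=
  (List.ofFn fun i : Fin m =>
    Matrix.transvection (0 : Fin 3) 1 (f i) * Matrix.transvection (1 : Fin 3) 2 (g i)).prod

def stairRt (m : ℕ) (f g : Fin m → R) : Matrix (Fin 3) (Fin 3) R :=
  (List.ofFn fun i : Fin m =>
    Matrix.transvection (0 : Fin 3) 1 (f (Fin.rev i)) *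
      Matrix.transvection (1 : Fin 3) 2 (g (Fin.rev i))).prod

theorem stairR_eq_map (m : ℕ) (f g : Fin m → R) :
    stairR m f g = ((List.ofFn fun i : Fin m => (f i, g i, f i * g i)).map
      fun t => U t.1 t.2.1 t.2.2).prod := by
  unfold stairR
  congr 1
  rw [List.map_ofFn]
  congr 1
  funext i
  simp [Function.comp, transvection01_mul_transvection12]

theorem stairRt_eq_map (m : ℕ) (f g : Fin m → R) :
    stairRt m f g = ((List.ofFn fun i : Fin m => (f (Fin.rev i), g (Fin.rev i),
      f (Fin.rev i) * g (Fin.rev i))).map fun t => U t.1 t.2.1 t.2.2).prod := by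
  unfold stairRt
  congr 1
  rw [List.map_ofFn]
  congr 1
  funext i
  simp [Function.comp, transvection01_mul_transvection12]

theorem exists_U_stairRt (m : ℕ) (f g : Fin m → R) : ∃ a b c : R, stairRt m f g = U a b c := by
  rw [stairRt_eq_map]; exact exists_U_of_prod _

theorem stairR_succ (m : ℕ) (f g : Fin (m + 1) → R) :
    stairR (m + 1) f g = stairR m (fun i => f i.castSucc) (fun i => g i.castSucc) *
      U (f (Fin.last m)) (g (Fin.last m)) (f (Fin.last m) * g (Fin.last m)) := by
  unfold stairR
  rw [List.ofFn_succ', List.concat_eq_append, List.prod_append, List.prod_singleton,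
    transvection01_mul_transvection12]

theorem stairRt_succ (m : ℕ) (f g : Fin (m + 1) → R) :
    stairRt (m + 1) f g = U (f (Fin.last m)) (g (Fin.last m)) (f (Fin.last m) * g (Fin.last m)) *
      stairRt m (fun i => f i.castSucc) (fun i => g i.castSucc) := by
  unfold stairRt
  rw [List.ofFn_succ, List.prod_cons, transvection01_mul_transvection12, Fin.rev_zero]
  simp only [Fin.rev_succ]

theorem hpp_mul_hpp : (hpp : Matrix (Fin 3) (Fin 3) R) * hpp = 1 := by
  ext i j
  fin_cases i <;> fin_cases j <;> simp [hpp, Matrix.mul_apply, Matrix.diagonal]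

/-- **Two-staircase identity.** -/
theorem twoStaircase (m : ℕ) (f g : Fin m → R) :
    stairR m f g * hpp * stairRt m f g * hpp = Matrix.transvection (0 : Fin 3) 2 (∑ i, f i * g i) := by
  induction m with
  | zero =>
      simp only [stairR, stairRt, List.ofFn_zero, List.prod_nil, Finset.univ_eq_empty,
        Finset.sum_empty, Matrix.transvection_zero, Matrix.one_mul]
      rw [Matrix.mul_assoc] ; simpa using (hpp_mul_hpp (R := R))
  | succ m ih =>
      have ih' := ih (fun i => f i.castSucc) (fun i => g i.castSucc)
      obtain ⟨a, b, c, hRt⟩ := exists_U_stairRt m (fun i => f i.castSucc) (fun i => g i.castSucc)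
      rw [stairR_succ, stairRt_succ, Fin.sum_univ_castSucc]
      set F := f (Fin.last m)
      set G := g (Fin.last m)
      set A := stairR m (fun i => f i.castSucc) (fun i => g i.castSucc)
      set B := stairRt m (fun i => f i.castSucc) (fun i => g i.castSucc)
      -- A * U * h * (U * B) * h = A * (U * (h U h)) * (h B h) ... use h*h = 1
      have key : A * U F G (F * G) * hpp * (U F G (F * G) * B) * hpp
          = U 0 0 (F * G) * (A * hpp * B * hpp) := by
        have h1 : A * U F G (F * G) * hpp * (U F G (F * G) * B) * hpp
            = A * (U F G (F * G) * (hpp * U F G (F * G) * hpp)) * (hpp * B * hpp) := by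
          have hh := hpp_mul_hpp (R := R)
          -- insert hpp*hpp = 1 between U and B
          calc A * U F G (F * G) * hpp * (U F G (F * G) * B) * hpp
              = A * U F G (F * G) * hpp * U F G (F * G) * (hpp * hpp) * B * hpp := by
                rw [hh]; simp [Matrix.mul_assoc]
            _ = A * (U F G (F * G) * (hpp * U F G (F * G) * hpp)) * (hpp * B * hpp) := by
                simp [Matrix.mul_assoc]
        rw [h1, hpp_U_hpp, U_mul]
        have hc : (F * G + F * G + F * -G) = F * G := by ring
        rw [hRt, hpp_U_hpp]
        simp only [add_neg_cancel]
        rw [hc]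
        -- now: A * U 0 0 (F*G) * U (-a) (-b) c = U 0 0 (F*G) * (A * hpp * U a b c * hpp)
        rw [show A * hpp * U a b c * hpp = A * (hpp * U a b c * hpp) by simp [Matrix.mul_assoc],
          hpp_U_hpp]
        obtain ⟨a', b', c', hA⟩ : ∃ a' b' c' : R, A = U a' b' c' := by
          rw [show A = stairR m (fun i => f i.castSucc) (fun i => g i.castSucc) from rfl,
            stairR_eq_map]; exact exists_U_of_prod _
        rw [hA, U_mul, U_mul, U_mul, U_mul]
        congr 1 <;> ring
      rw [key, ih', transvection02_eq_U, transvection02_eq_U, U_mul]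
      congr 1 <;> ring


/-- **`TwoStaircase` holds** (sorry-free): the calibration from above is a theorem. -/
theorem twoStaircase_holds : TwoStaircase := fun R _ m f g => twoStaircase m f g

end TwoStaircaseProof

end Summit.ValiantsHypothesis.ValiantsHypothesis.Cruxes.WordLengthQP.PositiveMonoidExits
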